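import Literature.AlgebraicGeometry.Frobenioids.ArchimedeanFSMFFCounterexample
import Literature.AlgebraicGeometry.Frobenioids.ArchimedeanFSMCounterexampleA
import Literature.AlgebraicGeometry.Frobenioids.ArchimedeanFSMOverIsoProofs
import Literature.AlgebraicGeometry.Frobenioids.ArchimedeanComplexifiable
import Literature.AlgebraicGeometry.Frobenioids.FSMIMorphisms
import HarnessLib

/-!
# Frobenioids II, Proposition 3.4 (viii) fails for `F = A` over `D = D₀` as well
# (abc-iut cell, layer L1, node `FrdII:Prop3.4(viii)`, chain LC-L1-2 — the `A`-conjunct of the typed item)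

Mochizuki, *The geometry of Frobenioids II: poly-Frobenioids*, Kyushu J. Math. **62** (2008)
401–460, §3, Proposition 3.4 (viii) p. 30 — stated for EACH `F ∈ {A, N, R}`: "Suppose that `D` is
complexifiable, RC-connected, and of FSMFF-type. Then `F` is … of FSMFF-type."
[cite: MochizukiFrdII2008, Prop 3.4 (viii) p.30]

PROOF-ONLY file (nothing is defined). `ArchimedeanFSMFFCounterexample.lean` (abc-iut-L1-d3) refutes the
typed item at `π = 𝟭 D₀` through the tower `F = N` (`towerN_id_not_propVIII`, whence
`not_prop34_viii_id`). Since print states (viii) separately for each `F`, this file records that the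
conclusion ALSO fails for the angular Frobenioid `F = A` over `D₀` (`towerA_id_not_propVIII`), by the same
route with Frobenius degrees allowed: (1) `A` over `D₀` has NO FSMI-morphism from a complex object to a
real object (`A.not_isFSMI_complex_real_id`) — if the domain is not isotropic the arrow factors through
the naive isotropic hull with two non-invertible isometric factors, so it is not irreducible; if the
domain is isotropic, the automorphism `(conj, 1, s)` with `s^d = c · conj(c)⁻¹` (a `d`-th root on `S¹`,
`d = deg_Fr`, `c` the scalar) has the same composite with the arrow as the identity, so the arrow is not
a monomorphism; (2) hence FSMI-chains out of complex objects end at complex objects; (3) but `A` over `D₀`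
HAS an FSM-morphism from a complex to a real object — extracted from abc-iut-L1-d3's refutation of (iii)
for `A` (`towerA_id_not_propIII`: an FSM-arrow of `A` whose projection is not FSM lies over
`Spec ℂ → Spec ℝ`) — which is not invertible and therefore would have to be such a chain. `D₀` satisfies
the typed hypotheses (abc-iut-L1-t4, `ArchimedeanBaseRC`). Only clause (a) of FSMFF-type is used (so the
2024 revision of clause (b) is immaterial). The cell's repaired reading (complex regime) is
`prop34_viii_of_isComplex` (abc-iut-w5-d152). No side is taken on [IUTchIII] Cor. 3.12.
-/

namespace Literature.AlgebraicGeometry.Frobenioids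

open CategoryTheory Set
open scoped Pointwise

noncomputable section

namespace ArchFrd

/-- A `d`-th root on the unit circle: for a unit `w` of absolute value `1` and `d ≥ 1` there is a unit
`s` with `s ^ d = w` and `|s| = 1`. [cite: MochizukiFrdII2008, Lem 3.2 (ii) p.26] -/
theorem exists_unit_pow_eq_of_absHom_eq_one (w : ℂˣ) (hw : absHom ℂ w = 1) (d : ℕ+) :
    ∃ s : ℂˣ, s ^ (d : ℕ) = w ∧ absHom ℂ s = 1 := by
  obtain ⟨z, hz⟩ := IsAlgClosed.exists_pow_nat_eq (w : ℂ) d.pos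
  have hz0 : z ≠ 0 := by
    intro h
    rw [h, zero_pow d.ne_zero] at hz
    exact w.ne_zero hz.symm
  refine ⟨Units.mk0 z hz0, Units.ext (by simp [hz]), ?_⟩
  have h1 : ‖(w : ℂ)‖ = 1 := by
    have := congrArg (fun r : PosReal => (r : ℝ)) hw
    rwa [coe_absHom] at this
  have hn : ‖z‖ ^ (d : ℕ) = 1 := by rw [← norm_pow, hz, h1]
  have hz1 : ‖z‖ = 1 := (pow_eq_one_iff_of_nonneg (norm_nonneg z) d.ne_zero).mp hn
  exact Subtype.ext (by rw [coe_absHom]; exact hz1)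

/-- In `A` over `D₀` there is no FSMI-morphism from a complex object to a real object.
[cite: MochizukiFrdII2008, Prop 3.4 (viii) p.33] -/
theorem A.not_isFSMI_complex_real_id {RP : AngularRegion ℂ}
    (hRP : D0.complex = D0.real → RP.IsIsotropic) {PD : D0}
    (ιP : (PreFrobenioid.baseFunctor C0.toElem).obj (C0.mk D0.complex RP hRP) ≅ (𝟭 D0).obj PD)
    {RQ : AngularRegion ℂ} (hRQ : D0.real = D0.real → RQ.IsIsotropic) {QD : D0}
    (ιQ : (PreFrobenioid.baseFunctor C0.toElem).obj (C0.mk D0.real RQ hRQ) ≅ (𝟭 D0).obj QD)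
    (φ : (⟨⟨C0.mk D0.complex RP hRP, PD, ιP⟩⟩ : A (𝟭 D0)) ⟶ ⟨⟨C0.mk D0.real RQ hRQ, QD, ιQ⟩⟩) :
    ¬ IsFSMI φ := by
  intro hφ
  set φ0 := φ.hom.fst with hφ0def
  set d : ℕ+ := C0.degFr φ0 with hddef
  have hI : PreFrobenioid.IsIsometry C0.toElem φ0 := φ.property
  have hφt : ‖((C0.scalar φ0 : ℂˣ) : ℂ)‖ * (RP.tip : ℝ) ^ (d : ℕ) = (RQ.tip : ℝ) :=
    (A0.isIsometry_iff_norm_mul_tip_pow φ0).mp hI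
  by_cases hisoP : RP.IsIsotropic
  · -- the automorphism `(conj, 1, s)`, `s^d = c · conj(c)⁻¹`, has the same composite with φ as the identity
    set c : ℂˣ := C0.scalar φ0 with hc
    have hw : absHom ℂ (c * (D0.galAct true c)⁻¹) = 1 := by
      rw [map_mul, map_inv, C0.absHom_galAct, mul_inv_cancel]
    obtain ⟨s, hsd, hs1⟩ := exists_unit_pow_eq_of_absHom_eq_one _ hw d
    have hmb : s • (C0.mk D0.complex RP hRP).region.carrier ^ ((1 : ℕ+) : ℕ) ⊆
        C0.pullRegion (C0.mk D0.complex RP hRP) D0.conj := by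
      rw [PNat.one_coe, pow_one]
      rintro _ ⟨u, hu, rfl⟩
      show s • u ∈ D0.conj.act '' RP.carrier
      unfold D0.Hom.act
      rw [D0.twists_conj, C0.image_galAct_of_isIsotropic hisoP, C0.mem_carrier_of_isIsotropic hisoP,
        smul_eq_mul, map_mul, hs1, one_mul]
      exact hu.2
    have hmem : s ∈ D0.scalars (C0.mk D0.complex RP hRP).base := by
      show _ ∈ D0.scalars D0.complex
      rw [D0.scalars_complex]
      exact Subgroup.mem_top _
    let b0 : C0.mk D0.complex RP hRP ⟶ C0.mk D0.complex RP hRP := ⟨D0.conj, 1, s, hmem, hmb⟩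
    have hb0I : PreFrobenioid.IsIsometry C0.toElem b0 := by
      rw [A0.isIsometry_iff_norm_mul_tip_pow]
      show ‖((s : ℂˣ) : ℂ)‖ * (RP.tip : ℝ) ^ ((1 : ℕ+) : ℕ) = (RP.tip : ℝ)
      rw [← coe_absHom, hs1, Positive.val_one, one_mul, PNat.one_coe, pow_one]
    have sq : (PreFrobenioid.baseFunctor C0.toElem).map b0 ≫ ιP.hom =
        ιP.hom ≫ (𝟭 D0).map (ιP.inv ≫ D0.conj ≫ ιP.hom) := by
      show D0.conj ≫ ιP.hom = ιP.hom ≫ (ιP.inv ≫ D0.conj ≫ ιP.hom)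
      exact (ιP.hom_inv_id_assoc _).symm
    let PC : C (𝟭 D0) := ⟨C0.mk D0.complex RP hRP, PD, ιP⟩
    let PA : A (𝟭 D0) := ⟨PC⟩
    let bC : PC ⟶ PC := ⟨b0, ιP.inv ≫ D0.conj ≫ ιP.hom, sq⟩
    have hbiso : PreFrobenioid.isometricMorphisms (C.toElem (𝟭 D0)) bC := hb0I
    let b : PA ⟶ PA := ⟨bC, hbiso⟩
    have heq : b ≫ φ = 𝟙 _ ≫ φ := by
      rw [Category.id_comp]
      apply WideSubcategory.hom_ext _
      refine CFP.hom_ext ?_ ?_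
      · show b0 ≫ φ0 = φ0
        refine C0.hom_ext (D0.hom_to_real_eq rfl _ _) ?_ ?_
        · rw [C0.degFr_comp']
          exact one_mul _
        · rw [C0.scalar_comp']
          show D0.galAct (D0.Hom.twists D0.conj) c * s ^ (d : ℕ) = c
          rw [D0.twists_conj, hsd, mul_left_comm, mul_inv_cancel, mul_one]
      · show (ιP.inv ≫ D0.conj ≫ ιP.hom) ≫ φ.hom.snd = φ.hom.snd
        exact (cancel_mono ιQ.inv).mp (D0.hom_to_real_eq rfl _ _)
    haveI := hφ.1.2
    have hb1 := (cancel_mono φ).mp heq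
    have hbase := congrArg (fun f => C0.Base f.hom.fst) hb1
    exact D0.conj_ne_id hbase
  · -- factor through the naive isotropic hull: neither factor is an isomorphism
    let RP' : AngularRegion ℂ := AngularRegion.isotropicOfTip RP.tip
    have hRP' : D0.complex = D0.real → RP'.IsIsotropic := fun h => nomatch h
    have hisoP' : RP'.IsIsotropic := AngularRegion.isIsotropic_isotropicOfTip _
    have hmβ : (1 : ℂˣ) • (C0.mk D0.complex RP hRP).region.carrier ^ ((1 : ℕ+) : ℕ) ⊆
        C0.pullRegion (C0.mk D0.complex RP' hRP') (𝟙 D0.complex) := by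
      rw [one_smul, PNat.one_coe, pow_one, C0.pullRegion_id]
      intro u hu
      rw [C0.mem_carrier_of_isIsotropic hisoP']
      exact hu.2
    let β0 : C0.mk D0.complex RP hRP ⟶ C0.mk D0.complex RP' hRP' := ⟨𝟙 D0.complex, 1, 1, one_mem _, hmβ⟩
    have hβI : PreFrobenioid.IsIsometry C0.toElem β0 := by
      rw [A0.isIsometry_iff_norm_mul_tip_pow]
      show ‖((1 : ℂˣ) : ℂ)‖ * (RP.tip : ℝ) ^ ((1 : ℕ+) : ℕ) = (RP.tip : ℝ)
      rw [Units.val_one, norm_one, one_mul, PNat.one_coe, pow_one]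
    have hmα : C0.scalar φ0 • (C0.mk D0.complex RP' hRP').region.carrier ^ (d : ℕ) ⊆
        C0.pullRegion (C0.mk D0.real RQ hRQ) (C0.Base φ0) := by
      have hq : C0.pullRegion (C0.mk D0.real RQ hRQ) (C0.Base φ0) = RQ.carrier := by
        show (C0.Base φ0).act '' RQ.carrier = RQ.carrier
        unfold D0.Hom.act
        rw [D0.twists_of_real, D0.image_galAct_false]
      rw [hq, ← d.natPred_add_one]
      refine (RP'.smul_carrier_pow_subset_iff RQ (C0.scalar φ0) d.natPred).mpr ⟨?_, ?_⟩
      · rw [show RQ.dir = univ from hRQ rfl]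
        exact subset_univ _
      · rw [d.natPred_add_one, ← Subtype.coe_le_coe]
        show (absHom ℂ (C0.scalar φ0) : ℝ) * ((RP.tip : ℝ) ^ (d : ℕ)) ≤ (RQ.tip : ℝ)
        rw [coe_absHom, hφt]
    let α0 : C0.mk D0.complex RP' hRP' ⟶ C0.mk D0.real RQ hRQ :=
      ⟨(C0.Base φ0 :), d, C0.scalar φ0, φ0.scalar_mem, hmα⟩
    have hαI : PreFrobenioid.IsIsometry C0.toElem α0 := by
      rw [A0.isIsometry_iff_norm_mul_tip_pow]
      show ‖((C0.scalar φ0 : ℂˣ) : ℂ)‖ * (RP.tip : ℝ) ^ (d : ℕ) = (RQ.tip : ℝ)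
      exact hφt
    have hβα : β0 ≫ α0 = φ0 := by
      refine C0.hom_ext (D0.hom_to_real_eq rfl _ _) ?_ ?_
      · rw [C0.degFr_comp']
        exact one_mul _
      · rw [C0.scalar_comp']
        show D0.galAct (D0.Hom.twists (𝟙 D0.complex)) (C0.scalar φ0) * 1 ^ (d : ℕ) = C0.scalar φ0
        rw [D0.twists_id, D0.galAct_false, one_pow, mul_one]
    -- in `A`
    let PC : C (𝟭 D0) := ⟨C0.mk D0.complex RP hRP, PD, ιP⟩
    let PA : A (𝟭 D0) := ⟨PC⟩
    let P'C : C (𝟭 D0) := ⟨C0.mk D0.complex RP' hRP', PD, ιP⟩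
    let P' : A (𝟭 D0) := ⟨P'C⟩
    let QC : C (𝟭 D0) := ⟨C0.mk D0.real RQ hRQ, QD, ιQ⟩
    let QA : A (𝟭 D0) := ⟨QC⟩
    have sqβ : (PreFrobenioid.baseFunctor C0.toElem).map β0 ≫ ιP.hom = ιP.hom ≫ (𝟭 D0).map (𝟙 PD) := by
      show 𝟙 D0.complex ≫ ιP.hom = ιP.hom ≫ 𝟙 PD
      exact (Category.id_comp _).trans (Category.comp_id _).symm
    let βC : PC ⟶ P'C := ⟨β0, 𝟙 PD, sqβ⟩
    have hβiso : PreFrobenioid.isometricMorphisms (C.toElem (𝟭 D0)) βC := hβI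
    let β : PA ⟶ P' := ⟨βC, hβiso⟩
    have wα : (PreFrobenioid.baseFunctor C0.toElem).map α0 ≫ ιQ.hom = ιP.hom ≫ (𝟭 D0).map φ.hom.snd :=
      φ.hom.w
    let αC : P'C ⟶ QC := ⟨α0, φ.hom.snd, wα⟩
    have hαiso : PreFrobenioid.isometricMorphisms (C.toElem (𝟭 D0)) αC := hαI
    let α : P' ⟶ QA := ⟨αC, hαiso⟩
    have hfac : β ≫ α = φ := by
      apply WideSubcategory.hom_ext _
      exact CFP.hom_ext hβα (Category.id_comp _)
    rcases hφ.2.2 β α hfac with hα | hβ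
    · haveI := hα
      exact (D0.isEmpty_hom_real_complex.false (C0.Base (inv α).hom.fst)).elim
    · haveI := hβ
      exact hisoP (C0.dir_eq_univ_of_hom (inv β).hom.fst rfl)

/-- A single FSMI step of `A` over `D₀` out of a complex object ends at a complex object.
[cite: MochizukiFrdII2008, Prop 3.4 (viii) p.33] -/
theorem A.base_complex_of_isFSMI_id {P Q : A (𝟭 D0)} (φ : P ⟶ Q) (hφ : IsFSMI φ)
    (hP : P.obj.fst.base = D0.complex) : Q.obj.fst.base = D0.complex := by
  obtain ⟨⟨⟨KP, RP, hRP⟩, PD, ιP⟩⟩ := P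
  obtain ⟨⟨⟨KQ, RQ, hRQ⟩, QD, ιQ⟩⟩ := Q
  change KP = D0.complex at hP
  subst hP
  cases KQ with
  | complex => rfl
  | real => exact (A.not_isFSMI_complex_real_id hRP ιP hRQ ιQ φ hφ).elim

/-- Every finite chain of FSMI-morphisms of `A` over `D₀` starting at a complex object ends at a
complex object. [cite: MochizukiFrdII2008, Prop 3.4 (viii) p.33] -/
theorem A.base_complex_of_isFSMIChain_id {P Q : A (𝟭 D0)} {φ : P ⟶ Q} {n : ℕ}
    (h : IsFSMIChain φ n) : P.obj.fst.base = D0.complex → Q.obj.fst.base = D0.complex := by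
  induction h with
  | single φ hφ => exact fun hP => A.base_complex_of_isFSMI_id φ hφ hP
  | cons ψ χ n hψ _ ih => exact fun hP => ih (A.base_complex_of_isFSMI_id ψ hψ hP)

/-- `A` over `D₀` has an FSM-morphism from a complex object to a real object — read off the refutation
of item (iii) for `A` (`towerA_id_not_propIII`): an FSM-arrow of `A` whose projection to `D₀` is not an
FSM-morphism lies over `Spec ℂ → Spec ℝ` (every other arrow of `D₀` is an isomorphism).
[cite: MochizukiFrdII2008, Prop 3.4 (iii) p.30] -/
theorem A.exists_isFSM_complex_real_id :
    ∃ (P Q : A (𝟭 D0)) (φ : P ⟶ Q), IsFSM φ ∧ P.obj.fst.base = D0.complex ∧ Q.obj.fst.base = D0.real := by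
  by_contra h
  push Not at h
  refine towerA_id_not_propIII (fun P Q φ hφ => ?_)
  change IsFSM φ.hom.snd
  rcases D0.isIso_or_eq φ.hom.snd with hi | ⟨hP, hQ⟩
  · haveI := hi
    exact IsFSM.of_isIso _
  · have hPc : P.obj.fst.base = D0.complex := by
      rcases D0.isReal_or_isComplex P.obj.fst.base with hr | hc
      · exact (D0.isEmpty_hom_real_complex.false (eqToHom hr.symm ≫ P.obj.iso.hom ≫ eqToHom hP)).elim
      · exact hc
    have hQr : Q.obj.fst.base = D0.real := D0.isReal_of_iso Q.obj.iso hQ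
    exact (h P Q φ hφ hPc hQr).elim

/-- **`A` over `D₀` is NOT of FSMFF-type**: the complex → real FSM-morphism of
`A.exists_isFSM_complex_real_id` is not invertible and admits no factorization into FSMI-morphisms.
[cite: MochizukiFrdII2008, Prop 3.4 (viii) p.30] -/
theorem A_id_not_isOfFSMFFType : ¬ IsOfFSMFFType (A (𝟭 D0)) := by
  intro h
  obtain ⟨P, Q, φ, hFSM, hP, hQ⟩ := A.exists_isFSM_complex_real_id
  have hnotIso : ¬ IsIso φ := by
    intro hi
    exact D0.isEmpty_hom_real_complex.false
      (eqToHom hQ.symm ≫ C0.Base (inv φ).hom.fst ≫ eqToHom hP)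
  obtain ⟨n, hchain⟩ := h.factors φ hFSM hnotIso
  have := A.base_complex_of_isFSMIChain_id hchain hP
  rw [hQ] at this
  exact nomatch this

/-- **Prop. 3.4 (viii) fails for `F = A` over `D = D₀`** (`D₀` is complexifiable, RC-connected and of
FSMFF-type — `ArchimedeanBaseRC` — but the angular Frobenioid `A` over it is not of FSMFF-type).
[cite: MochizukiFrdII2008, Prop 3.4 (viii) p.30] -/
theorem towerA_id_not_propVIII : ¬ (towerA (𝟭 D0)).PropVIII :=
  fun h => A_id_not_isOfFSMFFType
    (h D0.rc_isComplexifiable_id_comp D0.rc_isRCConnected_id_comp D0.isOfFSMFFType).2.2.2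

end ArchFrd

end

end Literature.AlgebraicGeometry.Frobenioids
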